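import Summits.Ventures.QEDPrecision.Diagrams.VolkovOnShellSetsOrder10C131ClosesFinal
import Summits.Ventures.QEDPrecision.Diagrams.VolkovOnShellSetsOrder10C131RigidFinal

/-!
Venture QEDPrecision / cell `pub-qed`, unit `pub-qed-int-2` (INT-2, gen 9). HONEST FRAMING: independent recomputation; certified
where stated, statistical where stated; no new-physics claim.  NEW WORK of the cell (a kernel-checked formal identity in the
unit's OWN model), not a published result: nothing here is cited as a fact anywhere; the printed sources are named only in
comments.
Staged copy: HOME/lean/int2/VolkovOnShellSetsOrder10C131Indivisible.lean (declarations byte-identical).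

# Five loops: the class (1;3,1) closes and admits NO proper non-empty closing subset (summary)

The three kernel-certified facts of `…C131ClosesFinal` and `…C131RigidFinal` side by side: the class (1;3,1) — 148 graphs,
`rows131` — closes, its certificate columns are as tabulated, and forcing along them from single rows ends with ONE class; hence
(soundness of forcing, `VolkovOnShellSetsGrouped` / `VolkovOnShellSetsMinimal`) no proper non-empty subset of the class closes
in the unit's formal Ward-identity model.  Companion of `class122_indivisible` (`…C122`).  NOT CLAIMED: as in
`VolkovOnShellSetsOrder10C122`.
-/

namespace Summit.Ventures.QEDPrecision.Diagrams

/-- the class (1;3,1) closes, its certificate columns are as tabulated, forcing along them ends with one class — so no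
proper non-empty subset of the class closes (in the model). -/
theorem class131_indivisible :
    closes 5 rows131 perm131 = true ∧
      colTable 5 rows131 keys131 perm131 = cert131.map (fun mc => mc.2) ∧
      rigidCols perm131 (cert131.map (fun mc => mc.2)) = true :=
  ⟨class131_closes, class131_columns, class131_rigid⟩

end Summit.Ventures.QEDPrecision.Diagrams
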